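import Literature.Analysis.FluidPDE.AlexakisDoeringProofs
import Literature.Analysis.FluidPDE.NSEnstrophyBalance2DProofs
import Literature.Analysis.FluidPDE.NSEnergyClassEnergyEquality
import Literature.Analysis.FluidPDE.NSUniqueness2DProofs
import Literature.Analysis.FluidPDE.LerayHopfUniformEnergyMomentum
import HarnessLib

/-!
# Solo (blind) — monoscale forcing on `𝕋²`: no enstrophy cascade, no dissipation floor

The planar leaf of the zeroth-law question. On `𝕋² = (ℝ/ℤ)²` let `f` be a smooth, divergence
free, mean zero steady force which is **monoscale** (single shell): `Δf = -Λ f` pointwise, `Λ ≥ 0`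
(every Kolmogorov force `F sin(2πk x₂) e₁`, every eigenfunction of the Stokes operator). For
`ν > 0`, smooth `u₀` and ANY global Leray–Hopf solution `u` of the Navier–Stokes equations driven
by `f` (on `𝕋²` it is unique and satisfies the energy EQUALITY, Lions–Prodi), with the
`limsup`-Cesàro means `ε = meanDissipation ν u = ⟨ν‖∇u‖₂²⟩`,
`χ = meanEnstrophyDissipation ν u = ⟨ν‖Δu‖₂²⟩`, `⟨‖u‖₂²⟩ = meanEnergy u` of `ZerothLaw`:

* `meanEnstrophyDissipation_le_of_monoscale`: **`χ ≤ Λ ε`**;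
* `meanDissipation_le_of_monoscale`: **`ε ≤ Λ ν ⟨‖u‖₂²⟩`**, i.e. the mean enstrophy obeys
  `⟨‖∇u‖₂²⟩ ≤ Λ ⟨‖u‖₂²⟩` UNIFORMLY IN `ν` (no enstrophy cascade under monoscale forcing);
* `meanDissipation_le_of_monoscale_family`: along any family `(ν_j, u₀_j, u_j)` of such flows
  with `meanEnergy (u_j) ≤ E`: `meanDissipation (ν_j) (u_j) ≤ Λ E ν_j`; hence
  (`not_planarZerothLaw_of_monoscale`) the planar, monoscale instance of the `ZerothLaw` matrix
  (`ν_j → 0`, bounded mean energy, dissipation floor `ε > 0`) has NO witness: dissipation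
  vanishes at rate `ν`, one power better than the Alexakis–Doering rate `ν^{1/2}`
  (`turb.S25`) valid for all smooth forces.

Mechanism (two lines on paper): the vorticity source of a monoscale force is proportional to
its power input, `(curl f, ω) = (-Δf, u) = Λ (f, u)`, so the enstrophy balance
`ν∫₀ᵗ‖Δu‖² ≤ ½‖∇u₀‖² + Λ∫₀ᵗ(f,u)` (FMRT (A.65), tree fact `fmrt_enstrophy_balance_torus2`,
discharged) and the energy equality `∫₀ᵗ(f,u) = ½‖u(t)‖² - ½‖u₀‖² + ν∫₀ᵗ‖∇u‖²`
(`Torus.WeakNSEnergyClass.energy_eq_zero`, Ladyzhenskaya `L⁴` bound) give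
`ν∫₀ᵗ‖Δu‖² ≤ C + Λ ν∫₀ᵗ‖∇u‖²` with `C` uniform in `t` by the uniform `L²` bound of the
trajectory (`IsGlobalLerayHopf.exists_forall_integral_norm_sq_le_of_hasZeroMean`); divide by `t`,
`limsup`: `χ ≤ Λε`; with Alexakis–Doering's interpolation `ε² ≤ ν⟨‖u‖²⟩χ`
(`meanDissipation_sq_le_of_regular`, here fed with bounded energy means instead of `U > 0`):
`ε ≤ Λν⟨‖u‖²⟩`. For statistically stationary flows this is the classical observation that
monoscale forcing puts the enstrophy AT the forcing scale (Constantin–Foias–Manley 1994;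
Alexakis–Doering 2006 §2 with `k_f` fixed); here it is proved for every Leray–Hopf flow in the
`limsup` vocabulary of the summit statement, with no stationarity and no `U > 0` hypothesis.
[cite: AlexakisDoering2006PLA, §2 eqs. (16), (21); cite: FoiasManleyRosaTemam2001, Ch. II
(A.65)]
-/

open MeasureTheory Filter Topology Set UnitAddTorus
open scoped ENNReal NNReal InnerProductSpace RealInnerProductSpace

noncomputable section

namespace Summit.AnomalousDissipation.AnomalousDissipation.Theorems

open Literature.Analysis.FunctionSpaces Literature.Analysis.FluidPDE

variable {ν Λ : ℝ} {f u₀ : UnitAddTorus (Fin 2) → EuclideanSpace ℝ (Fin 2)}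
  {u : ℝ → UnitAddTorus (Fin 2) → EuclideanSpace ℝ (Fin 2)}

/-! ### The energy equality of a 2-D Leray–Hopf flow under a steady smooth force -/

/-- **Energy equality from `0`** for a global Leray–Hopf solution on `𝕋²` with smooth steady
force and smooth datum: `½‖u(t)‖² + ν∫₀ᵗ‖∇u‖² = ½‖u₀‖² + ∫₀ᵗ∫⟪f,u⟫` for every `t > 0`
(Lions–Prodi; tree: `Torus.WeakNSEnergyClass.energy_eq_zero` with the Ladyzhenskaya bound
`∫₀ᵗ‖u‖₄⁴ < ∞` of `Torus.IsLerayHopfOn.lintegral_lintegral_enorm_pow_four_lt_top`).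
[cite: FoiasManleyRosaTemam2001, Ch. II Thm. 7.3] -/
theorem lh_energy_eq_two (hν : 0 < ν) (hf : Torus.IsSmooth f) (hu₀ : Torus.IsSmooth u₀)
    (hu : Torus.IsGlobalLerayHopf ν (fun _ => f) u₀ u) {t : ℝ} (ht : 0 < t) :
    Torus.kineticEnergy (u t) + ν * (∫⁻ τ in Ioo 0 t, Torus.eGradNormSq (u τ)).toReal =
      Torus.kineticEnergy u₀ + ∫ τ in Ioc 0 t, ∫ x, ⟪f x, u τ x⟫ := by
  have h := hu t ht
  have hfm := aestronglyMeasurable_stLift_const hf (volume.restrict (Ioo 0 t ×ˢ univ))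
  have hf2 := lintegral_enorm_sq_const_lt_top hf t
  have hL4 := h.lintegral_lintegral_enorm_pow_four_lt_top hν.le hfm hf2
  have hfL : MemLqLp 1 2 (fun _ : ℝ => f) (Ioo 0 t) :=
    memLqLp_of_ae_eLpNorm_le (hf.memLp 2).eLpNorm_ne_top measure_Ioo_lt_top.ne
      (ae_of_all _ fun _ => hf.memLp 2) (ae_of_all _ fun _ => le_rfl)
  have he := Torus.WeakNSEnergyClass.energy_eq_zero (by simp) (by simp) h.weak h.energy_bound
    h.memLp h.memL2Sobolev h.weak_continuous (hu₀.memLp 2) hL4 hfm hfL t ⟨ht, le_rfl⟩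
  rwa [intervalIntegral.integral_of_le ht.le] at he

/-! ### Monoscale forcing: the vorticity source is `Λ ×` the power input -/

/-- `∫⟪Δf, v⟫ = -Λ ∫⟪f, v⟫` when `Δf = -Λ f`. [folklore] -/
theorem integral_inner_laplacian_of_monoscale (hlap : ∀ x, Torus.laplacian f x = -(Λ • f x))
    (v : UnitAddTorus (Fin 2) → EuclideanSpace ℝ (Fin 2)) :
    ∫ x, ⟪Torus.laplacian f x, v x⟫ = -Λ * ∫ x, ⟪f x, v x⟫ := by
  rw [← integral_const_mul]
  refine integral_congr_ae (ae_of_all _ fun x => ?_)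
  show ⟪Torus.laplacian f x, v x⟫ = -Λ * ⟪f x, v x⟫
  rw [hlap x, inner_neg_left, real_inner_smul_left]
  ring

/-- **Enstrophy balance under monoscale forcing**: for every `t > 0`,
`ν∫₀ᵗ‖Δu‖² ≤ ½‖∇u₀‖² + Λ (½‖u(t)‖² - ½‖u₀‖² + ν∫₀ᵗ‖∇u‖²)` (FMRT enstrophy balance
`fmrt_enstrophy_balance_torus2` with `-∫⟪Δf,u⟫ = Λ∫⟪f,u⟫`, and the energy equality for the
work). [cite: FoiasManleyRosaTemam2001, Ch. II (A.65)–(A.67)] -/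
theorem monoscale_enstrophy_le (hν : 0 < ν) (hf : Torus.IsSmooth f) (hfdiv : Torus.IsDivFree f)
    (hfmean : Torus.HasZeroMean f) (hlap : ∀ x, Torus.laplacian f x = -(Λ • f x))
    (hu₀ : Torus.IsSmooth u₀) (hu : Torus.IsGlobalLerayHopf ν (fun _ => f) u₀ u) {t : ℝ}
    (ht : 0 < t) :
    ν * ∫ s in Ioc 0 t, (eLaplacianNormSq (u s)).toReal ≤
      2⁻¹ * (Torus.eGradNormSq u₀).toReal +
        Λ * (Torus.kineticEnergy (u t) - Torus.kineticEnergy u₀ +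
          ν * (∫⁻ τ in Ioo 0 t, Torus.eGradNormSq (u τ)).toReal) := by
  have h1 := fmrt_enstrophy_balance_torus2.dissipation_integral_le
    fmrt_enstrophy_balance_torus2_holds hν hf hfdiv hfmean hu₀.memSobolev_one_complexify
    hu.isWeaklyDivFree_datum hu ht
  have h2 : ∫ s in Ioc 0 t, ∫ x, ⟪Torus.laplacian f x, u s x⟫ =
      -Λ * ∫ s in Ioc 0 t, ∫ x, ⟪f x, u s x⟫ := by
    rw [← integral_const_mul]
    exact integral_congr_ae (ae_of_all _ fun s => integral_inner_laplacian_of_monoscale hlap _)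
  have h3 := lh_energy_eq_two hν hf hu₀ hu ht
  have hW : ∫ s in Ioc 0 t, ∫ x, ⟪f x, u s x⟫ =
      Torus.kineticEnergy (u t) - Torus.kineticEnergy u₀ +
        ν * (∫⁻ τ in Ioo 0 t, Torus.eGradNormSq (u τ)).toReal := by
    linarith
  rw [h2, hW] at h1
  linarith

/-- **Uniform form**: there is `C` (depending on `u₀`, `f`, `ν`, `u` but not on `t`) with
`ν∫₀ᵗ‖Δu‖² ≤ C + Λ ν∫₀ᵗ‖∇u‖²` for every `t > 0` — the kinetic energy of the trajectory is
bounded uniformly in time (`IsGlobalLerayHopf.exists_forall_integral_norm_sq_le_of_hasZeroMean`,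
FMRT (A.42)). [cite: FoiasManleyRosaTemam2001, Ch. IV §3.1 (3.2)] -/
theorem monoscale_enstrophy_le_uniform (hν : 0 < ν) (hf : Torus.IsSmooth f)
    (hfdiv : Torus.IsDivFree f) (hfmean : Torus.HasZeroMean f) (hΛ : 0 ≤ Λ)
    (hlap : ∀ x, Torus.laplacian f x = -(Λ • f x)) (hu₀ : Torus.IsSmooth u₀)
    (hu : Torus.IsGlobalLerayHopf ν (fun _ => f) u₀ u) :
    ∃ C : ℝ, ∀ t, 0 < t → ν * ∫ s in Ioc 0 t, (eLaplacianNormSq (u s)).toReal ≤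
      C + Λ * (ν * (∫⁻ τ in Ioo 0 t, Torus.eGradNormSq (u τ)).toReal) := by
  obtain ⟨R, hR⟩ := hu.exists_forall_integral_norm_sq_le_of_hasZeroMean hν (hf.memLp 2) hfmean
  refine ⟨2⁻¹ * (Torus.eGradNormSq u₀).toReal + Λ * (2⁻¹ * R), fun t ht => ?_⟩
  have h := monoscale_enstrophy_le hν hf hfdiv hfmean hlap hu₀ hu ht
  have hKE : Torus.kineticEnergy (u t) = 2⁻¹ * ∫ x, ‖u t x‖ ^ 2 := rfl
  have hKEt : Torus.kineticEnergy (u t) ≤ 2⁻¹ * R := by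
    rw [hKE]; linarith [hR t ht.le]
  have h1 := mul_le_mul_of_nonneg_left hKEt hΛ
  have h2 := mul_nonneg hΛ (Torus.kineticEnergy_nonneg u₀)
  nlinarith [h, h1, h2]

/-! ### `χ ≤ Λ ε` and the `ν`-uniform enstrophy bound -/

/-- **No enstrophy cascade under monoscale forcing, `χ ≤ Λ ε`**: on `𝕋²`, for `ν > 0`, a smooth
steady divergence-free mean-zero force with `Δf = -Λf` (`Λ ≥ 0`), smooth `u₀` and any global
Leray–Hopf solution `u`: `meanEnstrophyDissipation ν u ≤ Λ · meanDissipation ν u`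
(`limsup`-Cesàro means of `ZerothLaw`). [cite: AlexakisDoering2006PLA, §2 eq. (16)] -/
theorem meanEnstrophyDissipation_le_of_monoscale (hν : 0 < ν) (hf : Torus.IsSmooth f)
    (hfdiv : Torus.IsDivFree f) (hfmean : Torus.HasZeroMean f) (hΛ : 0 ≤ Λ)
    (hlap : ∀ x, Torus.laplacian f x = -(Λ • f x)) (hu₀ : Torus.IsSmooth u₀)
    (hu : Torus.IsGlobalLerayHopf ν (fun _ => f) u₀ u) :
    meanEnstrophyDissipation ν u ≤ Λ * meanDissipation ν u := by
  obtain ⟨C, hC⟩ := monoscale_enstrophy_le_uniform hν hf hfdiv hfmean hΛ hlap hu₀ hu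
  set g : ℝ → ℝ := timeMean fun s => ν * (eLaplacianNormSq (u s)).toReal with hg
  set e : ℝ → ℝ := timeMean fun s => ν * (Torus.eGradNormSq (u s)).toReal with he
  change limsup g atTop ≤ Λ * limsup e atTop
  -- pointwise in the window: `g t ≤ C/t + Λ e t`
  have hstep : ∀ t, 0 < t → g t ≤ C * t⁻¹ + Λ * e t := by
    intro t ht
    have hLH := hu t ht
    have hmeas := hLH.aemeasurable_eGradNormSq
    have hfin := hLH.lintegral_eGradNormSq_lt_top
    have hlt : ∀ᵐ τ ∂(volume.restrict (Ioo 0 t)), Torus.eGradNormSq (u τ) < ⊤ :=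
      ae_lt_top' hmeas hfin.ne
    have he' : e t = t⁻¹ * (ν * (∫⁻ τ in Ioo 0 t, Torus.eGradNormSq (u τ)).toReal) := by
      simp only [he, timeMean]
      rw [intervalIntegral.integral_of_le ht.le, integral_Ioc_eq_integral_Ioo, integral_const_mul,
        integral_toReal hmeas hlt]
    have hg' : g t = t⁻¹ * (ν * ∫ s in Ioc 0 t, (eLaplacianNormSq (u s)).toReal) := by
      simp only [hg, timeMean]
      rw [intervalIntegral.integral_of_le ht.le, integral_const_mul]
    rw [he', hg']
    have ht' : 0 ≤ t⁻¹ := inv_nonneg.2 ht.le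
    calc t⁻¹ * (ν * ∫ s in Ioc 0 t, (eLaplacianNormSq (u s)).toReal)
        ≤ t⁻¹ * (C + Λ * (ν * (∫⁻ τ in Ioo 0 t, Torus.eGradNormSq (u τ)).toReal)) :=
          mul_le_mul_of_nonneg_left (hC t ht) ht'
      _ = C * t⁻¹ + Λ * (t⁻¹ * (ν * (∫⁻ τ in Ioo 0 t, Torus.eGradNormSq (u τ)).toReal)) := by
          ring
  have hg0 : ∀ᶠ t in atTop, 0 ≤ g t := by
    filter_upwards [eventually_ge_atTop 0] with t ht
    exact timeMean_nonneg (fun s => mul_nonneg hν.le ENNReal.toReal_nonneg) ht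
  have heb : IsBoundedUnder (· ≤ ·) atTop e :=
    hu.isBoundedUnder_timeMean_dissipation hν (hf.memLp 2) hfmean
  have hCt : Tendsto (fun t : ℝ => C * t⁻¹) atTop (𝓝 0) := by
    simpa using tendsto_inv_atTop_zero.const_mul C
  refine limsup_le_of_forall_pos_eventually_le (h := fun δ => δ + Λ * (limsup e atTop + δ))
    hg0 (fun δ hδ => ?_) ?_
  · have heδ : ∀ᶠ t in atTop, e t < limsup e atTop + δ :=
      eventually_lt_of_limsup_lt (by linarith) heb
    have hCδ : ∀ᶠ t in atTop, C * t⁻¹ ≤ δ := hCt.eventually (ge_mem_nhds hδ)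
    filter_upwards [heδ, hCδ, eventually_gt_atTop 0] with t het hCt' ht
    calc g t ≤ C * t⁻¹ + Λ * e t := hstep t ht
      _ ≤ δ + Λ * (limsup e atTop + δ) :=
          add_le_add hCt' (mul_le_mul_of_nonneg_left het.le hΛ)
  · have hc : Continuous fun δ : ℝ => δ + Λ * (limsup e atTop + δ) :=
      continuous_id.add (continuous_const.mul (continuous_const.add continuous_id))
    have h0 : (fun δ : ℝ => δ + Λ * (limsup e atTop + δ)) 0 = Λ * limsup e atTop := by simp
    rw [← h0]
    exact (hc.tendsto 0).mono_left nhdsWithin_le_nhds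

/-- The running means of the energy of a global Leray–Hopf flow with steady smooth mean-zero
force are eventually bounded (uniform `L²` bound of the trajectory, FMRT (3.2)); replaces the
hypothesis `U > 0` of the tree's `ε² ≤ νU²χ`. [cite: FoiasManleyRosaTemam2001, Ch. IV §3.1 (3.2)] -/
theorem isBoundedUnder_timeMean_energy (hν : 0 < ν) (hf : Torus.IsSmooth f)
    (hfmean : Torus.HasZeroMean f) (hu : Torus.IsGlobalLerayHopf ν (fun _ => f) u₀ u) :
    IsBoundedUnder (· ≤ ·) atTop (timeMean fun s => ∫ x, ‖u s x‖ ^ 2) := by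
  obtain ⟨R, hR⟩ := hu.exists_forall_integral_norm_sq_le_of_hasZeroMean hν (hf.memLp 2) hfmean
  refine ⟨R, ?_⟩
  rw [Filter.eventually_map]
  filter_upwards [eventually_gt_atTop (0 : ℝ)] with T hT
  unfold timeMean
  rw [intervalIntegral.integral_of_le hT.le]
  have hint : ∫ s in Ioc 0 T, ∫ x, ‖u s x‖ ^ 2 ≤ ∫ _ in Ioc 0 T, R :=
    setIntegral_mono_on (hu.integrableOn_integral_norm_sq hT)
      (integrableOn_const measure_Ioc_lt_top.ne) measurableSet_Ioc fun s hs => hR s hs.1.le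
  have hc : ∫ _ in Ioc 0 T, R = T * R := by
    rw [setIntegral_const, measureReal_def, Real.volume_Ioc, ENNReal.toReal_ofReal (by linarith),
      sub_zero, smul_eq_mul]
  rw [hc] at hint
  calc T⁻¹ * ∫ s in Ioc 0 T, ∫ x, ‖u s x‖ ^ 2 ≤ T⁻¹ * (T * R) :=
        mul_le_mul_of_nonneg_left hint (inv_nonneg.2 hT.le)
    _ = R := by field_simp

/-- **`ν`-uniform enstrophy bound under monoscale forcing, `ε ≤ Λ ν ⟨‖u‖₂²⟩`**: on `𝕋²`, for
`ν > 0`, a smooth steady divergence-free mean-zero force with `Δf = -Λf` (`Λ ≥ 0`), smooth `u₀`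
and any global Leray–Hopf solution `u`:
`meanDissipation ν u ≤ Λ · ν · meanEnergy u`, i.e. `⟨‖∇u‖₂²⟩ ≤ Λ⟨‖u‖₂²⟩` with a constant
independent of `ν` (from `χ ≤ Λε` and Alexakis–Doering's `ε² ≤ ν⟨‖u‖²⟩χ`).
[cite: AlexakisDoering2006PLA, §2 eqs. (16), (21)] -/
theorem meanDissipation_le_of_monoscale (hν : 0 < ν) (hf : Torus.IsSmooth f)
    (hfdiv : Torus.IsDivFree f) (hfmean : Torus.HasZeroMean f) (hΛ : 0 ≤ Λ)
    (hlap : ∀ x, Torus.laplacian f x = -(Λ • f x)) (hu₀ : Torus.IsSmooth u₀)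
    (hu : Torus.IsGlobalLerayHopf ν (fun _ => f) u₀ u) :
    meanDissipation ν u ≤ Λ * ν * meanEnergy u := by
  have hχ := meanEnstrophyDissipation_le_of_monoscale hν hf hfdiv hfmean hΛ hlap hu₀ hu
  have hRu := fmrt_enstrophy_balance_torus2_holds hν hf hfdiv hfmean
    hu₀.memSobolev_one_complexify hu.isWeaklyDivFree_datum hu
  have hineq : ∀ t, 0 < t → ν * ∫ s in Ioc 0 t, (eLaplacianNormSq (u s)).toReal ≤
      2⁻¹ * (Torus.eGradNormSq u₀).toReal - ∫ s in Ioc 0 t, ∫ x, ⟪Torus.laplacian f x, u s x⟫ :=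
    fun _ ht => fmrt_enstrophy_balance_torus2.dissipation_integral_le
      fmrt_enstrophy_balance_torus2_holds hν hf hfdiv hfmean hu₀.memSobolev_one_complexify
      hu.isWeaklyDivFree_datum hu ht
  have hEb := isBoundedUnder_timeMean_energy hν hf hfmean hu
  have htrick : meanDissipation ν u ^ 2 ≤
      ν * rmsVelocity longTimeAvgSup u ^ 2 * meanEnstrophyDissipation ν u := by
    refine meanDissipation_sq_le_of_regular hν.le ?_ (hu.ae_eLaplacianNormSq_ne_top hRu.1)
      hu.aestronglyMeasurable_toReal_eGradNormSq (fun T hT => hu.integrableOn_integral_norm_sq hT)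
      (fun T hT => (hu T hT).integrableOn_toReal_eLaplacianNormSq (hRu.1 T hT)) hEb
      (isBoundedUnder_timeMean_eLaplacianNormSq_of_enstrophyIneq hν hf hu hineq hEb)
    filter_upwards [ae_restrict_mem measurableSet_Ioi] with t ht
    exact hu.memLp_two (le_of_lt ht)
  have hU2 : rmsVelocity longTimeAvgSup u ^ 2 = meanEnergy u := by
    rw [rmsVelocity_eq_sqrt_meanEnergy, Real.sq_sqrt (meanEnergy_nonneg u)]
  rw [hU2] at htrick
  have hE0 : 0 ≤ meanEnergy u := meanEnergy_nonneg u
  set ε := meanDissipation ν u with hε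
  have hkey : ε ^ 2 ≤ ν * meanEnergy u * (Λ * ε) :=
    htrick.trans (mul_le_mul_of_nonneg_left hχ (mul_nonneg hν.le hE0))
  by_cases hε0 : ε ≤ 0
  · exact hε0.trans (by positivity)
  · push Not at hε0
    nlinarith [hkey, hε0, mul_nonneg (mul_nonneg hΛ hν.le) hE0]

/-! ### The planar monoscale instance of the zeroth-law matrix has no witness -/

/-- **Dissipation vanishes at rate `ν` along every monoscale-forced planar family**: for a
smooth steady divergence-free mean-zero force on `𝕋²` with `Δf = -Λf`, any viscosities
`ν_j > 0`, smooth data `u₀_j` and global Leray–Hopf solutions `u_j` with `meanEnergy (u_j) ≤ E`: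
`meanDissipation (ν_j) (u_j) ≤ Λ E ν_j` for every `j`. [cite: AlexakisDoering2006PLA, §2] -/
theorem meanDissipation_le_of_monoscale_family (hf : Torus.IsSmooth f)
    (hfdiv : Torus.IsDivFree f) (hfmean : Torus.HasZeroMean f) (hΛ : 0 ≤ Λ)
    (hlap : ∀ x, Torus.laplacian f x = -(Λ • f x)) {νs : ℕ → ℝ}
    {u₀s : ℕ → UnitAddTorus (Fin 2) → EuclideanSpace ℝ (Fin 2)}
    {us : ℕ → ℝ → UnitAddTorus (Fin 2) → EuclideanSpace ℝ (Fin 2)} (hν : ∀ j, 0 < νs j)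
    (hu₀ : ∀ j, Torus.IsSmooth (u₀s j))
    (hu : ∀ j, Torus.IsGlobalLerayHopf (νs j) (fun _ => f) (u₀s j) (us j)) {E : ℝ}
    (hE : ∀ j, meanEnergy (us j) ≤ E) (j : ℕ) :
    meanDissipation (νs j) (us j) ≤ Λ * E * νs j := by
  have h := meanDissipation_le_of_monoscale (hν j) hf hfdiv hfmean hΛ hlap (hu₀ j) (hu j)
  calc meanDissipation (νs j) (us j) ≤ Λ * νs j * meanEnergy (us j) := h
    _ ≤ Λ * νs j * E := mul_le_mul_of_nonneg_left (hE j) (mul_nonneg hΛ (hν j).le)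
    _ = Λ * E * νs j := by ring

/-- **No planar zeroth law under monoscale forcing** (smooth data): with `f`, `Λ` as above,
there is NO family `ν_j → 0⁺`, smooth `u₀_j`, global Leray–Hopf `u_j` with bounded mean energy
and a positive floor `ε ≤ meanDissipation (ν_j) (u_j)` — the `𝕋²`, single-shell instance of the
matrix of `Literature.Turb.ZerothLaw` is empty. [cite: AlexakisDoering2006PLA, §2] -/
theorem not_planarZerothLaw_of_monoscale (hf : Torus.IsSmooth f) (hfdiv : Torus.IsDivFree f)
    (hfmean : Torus.HasZeroMean f) (hΛ : 0 ≤ Λ) (hlap : ∀ x, Torus.laplacian f x = -(Λ • f x)) :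
    ¬ ∃ (νs : ℕ → ℝ) (u₀s : ℕ → UnitAddTorus (Fin 2) → EuclideanSpace ℝ (Fin 2))
        (us : ℕ → ℝ → UnitAddTorus (Fin 2) → EuclideanSpace ℝ (Fin 2)),
        (∀ j, 0 < νs j) ∧ Tendsto νs atTop (𝓝 0) ∧ (∀ j, Torus.IsSmooth (u₀s j)) ∧
          (∀ j, Torus.IsGlobalLerayHopf (νs j) (fun _ => f) (u₀s j) (us j)) ∧
          (∃ E : ℝ, ∀ j, meanEnergy (us j) ≤ E) ∧
          ∃ ε : ℝ, 0 < ε ∧ ∀ j, ε ≤ meanDissipation (νs j) (us j) := by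
  rintro ⟨νs, u₀s, us, hν, hν0, hu₀, hu, ⟨E, hE⟩, ε, hε, hfloor⟩
  have hb : ∀ j, ε ≤ Λ * E * νs j := fun j =>
    (hfloor j).trans (meanDissipation_le_of_monoscale_family hf hfdiv hfmean hΛ hlap hν hu₀ hu hE j)
  have hlim : Tendsto (fun j => Λ * E * νs j) atTop (𝓝 0) := by
    simpa using hν0.const_mul (Λ * E)
  have hev := hlim.eventually (gt_mem_nhds hε)
  obtain ⟨j, hj⟩ := hev.exists
  exact absurd (hb j) (not_le.2 hj)

end Summit.AnomalousDissipation.AnomalousDissipation.Theorems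

end
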